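import Mathlib
import Literature.Analysis.FluidPDE.VectorCalculus
import Literature.Analysis.FluidPDE.SelfSimilar
import Literature.Analysis.FluidPDE.MildSolution
import Literature.Analysis.FluidPDE.NSBoundedMildOseenClassical
import Summits.NavierStokesRegularity.NavierStokesRegularity.Theses.UnthreadedRigidityDoor
import Summits.NavierStokesRegularity.NavierStokesRegularity.Theorems.ThreadingFluxCentreJetDefs
import Summits.NavierStokesRegularity.NavierStokesRegularity.Theorems.ThreadingFluxPlatonicDefs
import Summits.NavierStokesRegularity.NavierStokesRegularity.Theorems.ThreadingFluxPlatonicWindowGlue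
import HarnessLib

/-!
# Crux `PoloidalLiouville` (stmt-NavierStokesRegularity-1222, W1) / `UnthreadedRigidity` (stmt-…-27585, W2), crux idea «platonic-germ-sieve»
# (ns-idea-15 g11, V27): the ANCIENT octahedral class from ⟨27585⟩, modulo honest Oseen-mildness

Support file (Theorems-side; seat ns-wall-eng-8 g6, cell `ns-wall-extremal`; `--supports stmt-NavierStokesRegularity-1222 --as helper`; 0 kit),
a corollary of the W2 wiring `Platonic.symmetricWindowRigidity_of_unthreadedRigidity` (`ThreadingFluxPlatonicWindowGlue.lean`) on the time window
`S = (−∞, 0)`: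

* ★ `Platonic.ancientOctahedral_eq_zero_of_unthreadedRigidity_of_oseenMild` — if `UnthreadedRigidity` holds, every bounded ancient mild solution
  (`IsBoundedAncientMildSolution 1 v`, KNSS class) which is smooth on `(−∞,0) × ℝ³`, HONESTLY Oseen-mild on `(−∞, 0)` (the pointwise identity
  `v t = e^{(t−s)Δ}v s − B_s(v,v)(t)`, carried as an explicit hypothesis exactly as the precession rung F
  `fastPrecessionPoloidalLiouville_of_shortPeriodCollapse` carries it), unthreaded about `0` and O-equivariant at every negative time, VANISHES on
  `t < 0`.  This is the conclusion of the card's `SymmetricPoloidalLiouville octahedral` (W1 restricted to the O-class) for the honest-mild members of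
  the class: modulo the duality-mild ⇒ pointwise-Oseen conversion, W1|_O sits below the W2 door.
* `Platonic.not_unthreadedRigidity_of_octahedralAncientSolution` — the contrapositive negation home: one non-zero honest-mild member of
  `SymmetricCounterexample octahedral` refutes ⟨27585⟩.

HONEST LABEL: conditional glue strictly below W1/W2 (hypothesis ⟨27585⟩ + honest mildness); `SymmetricPoloidalLiouville octahedral` BY NAME is NOT
claimed (the conversion from the duality-mild class is not in this file); ⟨1222⟩, ⟨27585⟩ and NS regularity are OPEN and NOT touched; information-grade
(movement 0).  [folklore]
-/

-- the summit and its single sub-problem share the name (CONVENTIONS §1)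
set_option linter.dupNamespace false

noncomputable section

open Set Function Filter Metric
open scoped RealInnerProductSpace Topology
open Literature.Analysis.FluidPDE
open Summit.NavierStokesRegularity.NavierStokesRegularity.Theses
open Summit.NavierStokesRegularity.NavierStokesRegularity.Theorems.PoloidalLiouville.CentreJet (E3)

namespace Summit.NavierStokesRegularity.NavierStokesRegularity.Theorems.PoloidalLiouville.Platonic

/-- ★ **The ancient octahedral class from ⟨27585⟩, modulo honest Oseen-mildness.**  See the module docstring. -/
theorem ancientOctahedral_eq_zero_of_unthreadedRigidity_of_oseenMild (h27585 : UnthreadedRigidityDoor.UnthreadedRigidity)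
    (v : ℝ → E3 → E3) (hv : IsBoundedAncientMildSolution 1 v)
    (hsm : ContDiffOn ℝ (⊤ : ℕ∞) (Function.uncurry v) (Iio 0 ×ˢ univ))
    (hmild : ∀ s ∈ Iio (0 : ℝ), ∀ t ∈ Iio (0 : ℝ), s < t → ∀ x, v t x =
        Literature.Analysis.UnboundedOperators.heatExtension (v s) (t - s) x - oseenDuhamel 1 s v v t x)
    (hun : ∀ t < 0, ∀ x, inner ℝ x (curl (v t) x) = 0) (hequi : ∀ t < 0, IsEquivariant octahedral (v t)) :
    ∀ t < 0, ∀ x, v t x = 0 := by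
  intro t ht x
  -- continuity on the window from smoothness
  have hcont : ContinuousOn (Function.uncurry v) (Iio (0 : ℝ) ×ˢ (univ : Set E3)) := hsm.continuousOn
  -- each negative slice is `C¹` on `ℝ³`, hence classically divergence free (weakly div-free by the mild class)
  have hslice : ∀ τ < (0 : ℝ), ContDiff ℝ 1 (v τ) := by
    intro τ hτ
    have hι : ContDiff ℝ (⊤ : ℕ∞) (fun y : E3 => ((τ, y) : ℝ × E3)) := contDiff_const.prodMk contDiff_id
    have hmem : ∀ y : E3, ((τ, y) : ℝ × E3) ∈ Iio (0 : ℝ) ×ˢ (univ : Set E3) := fun y => ⟨hτ, mem_univ y⟩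
    have h := hsm.comp_contDiff hι hmem
    exact h.of_le (by norm_cast)
  have hdiv : ∀ τ ∈ Iio (0 : ℝ), VectorCalculus.IsDivFree (v τ) :=
    fun τ hτ => (hv.1.1 τ hτ).isDivFree_of_contDiff (hslice τ hτ)
  -- boundedness on every past sub-window from the class
  have hbdd : ∀ τ ∈ Iio (0 : ℝ), ∃ B : ℝ, ∀ t ∈ Iio (0 : ℝ), t ≤ τ → ∀ y, ‖v t y‖ ≤ B := by
    intro τ _
    obtain ⟨C, hC⟩ := hv.2
    exact ⟨C, fun t ht _ y => hC t ht y⟩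
  have hun' : ∀ t ∈ Iio (0 : ℝ), ∀ y, inner ℝ (curl (v t) y) y = 0 :=
    fun t ht y => by rw [real_inner_comm]; exact hun t ht y
  have hequi' : ∀ t ∈ Iio (0 : ℝ), IsEquivariant octahedral (v t) := fun t ht => hequi t ht
  exact symmetricWindowRigidity_of_unthreadedRigidity h27585 (Iio 0) isOpen_Iio isPreconnected_Iio v hcont hdiv hmild hbdd
    hun' hequi' t ht x

/-- **Negation home (ancient, honest-mild).**  A bounded ancient mild solution, smooth and honestly Oseen-mild on `(−∞, 0)`, unthreaded about `0`,
O-equivariant, and non-zero at some negative time, refutes ⟨27585⟩ `UnthreadedRigidity`. -/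
theorem not_unthreadedRigidity_of_octahedralAncientSolution (v : ℝ → E3 → E3) (hv : IsBoundedAncientMildSolution 1 v)
    (hsm : ContDiffOn ℝ (⊤ : ℕ∞) (Function.uncurry v) (Iio 0 ×ˢ univ))
    (hmild : ∀ s ∈ Iio (0 : ℝ), ∀ t ∈ Iio (0 : ℝ), s < t → ∀ x, v t x =
        Literature.Analysis.UnboundedOperators.heatExtension (v s) (t - s) x - oseenDuhamel 1 s v v t x)
    (hun : ∀ t < 0, ∀ x, inner ℝ x (curl (v t) x) = 0) (hequi : ∀ t < 0, IsEquivariant octahedral (v t))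
    {t : ℝ} (ht : t < 0) {x : E3} (hx : v t x ≠ 0) : ¬ UnthreadedRigidityDoor.UnthreadedRigidity := fun h =>
  hx (ancientOctahedral_eq_zero_of_unthreadedRigidity_of_oseenMild h v hv hsm hmild hun hequi t ht x)

end Summit.NavierStokesRegularity.NavierStokesRegularity.Theorems.PoloidalLiouville.Platonic

end
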